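import Summits.AtomisticToContinuum.Crystallization.Theorems.ChargedEnergyGapBeamCells
import HarnessLib

/-!
# ChargedEnergyGap · NODE 78 «PoolCells» (lens-3 g78) — an ALTERNATIVE cut beneath 76R's leaf (KX), replacing the transport of NODE 77

Line of record: `stmt-AtomisticToContinuum-14231` (`Summit.AtomisticToContinuum.ChargedEnergyGap`); target = the cone binder `hKX` of
`chargedEnergyGap_of_roofCover_numerics`, VERBATIM

  (KX) `CreaseTransitionLedgerQ cls₀ 20 106 (1/3600000000) (3/5) (1/3) 3 (3/100) 160 80 (6/5) (3/2) (679/1000) (691/1000) (1/60000000) (1/2000000)`.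

## Why a new cut (negative knowledge on NODE 77's leaf (B_C))

NODE 77 pays every ACTIVE octahedron by EQUAL shares `atom(x)/beamCount(x)` of the budget atoms in its tube.  Desk census g78
(`num/out_hover_118_807.txt`, mean-field, the starved slab of g76: half-width `L = 118`, χ-cuts at `c = 80.7`, pattern `tt`, comb phase `0`):
the crease column contains ACTIVE TAME χ-touching «hoverer» octahedra at heights `|s| ∈ [11.68, 23.35]` (costs `≤ 0.056 c_T`, `0.47 c_T` per unit
area in total — activity is scale-invariant because `roofVal` is positively homogeneous) whose χ-beams run through the crease's starved upper column;
equal sharing hands them `9.7` of the column's `34.15 c_T` per unit area, the crease collects `24.42 < 28.91` = its cost: ratio `1.184`.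
So (B_C) `CreaseBeamQ … 3 20 130 …` is FALSE-leaning at the very configuration that fixes the margin of (KX) (global K-ratio `0.847` there).
Cost-PROPORTIONAL sharing repairs the crease (`34.10`, ratio `0.848`) but starves the hoverers' own leaf (their coverage `≈ 0.03–0.15`); and
beams that follow the gradient congruence of `dist(·, C)` CONVERGE at point cores: in the STARVED DIPOLE (two point cores `236` apart, χ-balls of
radius `37.3`) the Jacobian `((d − s)/d)²` averaged against the column profile is `0.89`, so any transport of lateral reach `≪ 40` has apex
coverage `≈ 1.04` (desk `num/dipole.py`, `num/RESULTS-g78.md` H3).  NODE 78 answers all three.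

## The transport of NODE 78 (three moves)

* LIGHT / HEAVY.  An active octahedron is LIGHT if its cost `frameVal` is at most the budget atom of EACH of its six vertices; a light octahedron
  is paid by its own vertices: the ordered pair charges `frameVal/36` to each vertex (`charges`; in the cubic fcc reference a site is a vertex of
  `6` octahedra = `36` ordered mid pairs, so the charges at a site never exceed its atom).  Hoverers are light by a factor `≥ 6.3`.  The rest of the
  atom, `pool := max 0 (atom − charges)`, feeds the HEAVY octahedra.
* COST-PROPORTIONAL SHARING.  A heavy active octahedron `o` draws from every reference site `x` of its fattened tube the share
  `pool(x) · (frameVal(o)/6) / load(x)`, where `load(x)` is the sum of `frameVal/6` over the heavy active ordered pairs whose fattened tube contains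
  `x`; i.e. `(1/6)·frameVal(o) · coverage(o)` with `coverage(o) := Σ_x pool(x)/load(x)`.  The leaf per heavy octahedron is `1 ≤ coverage(o)` —
  INDEPENDENT of the octahedron's own cost.
* N-FATTENED BEAMS.  The fattened tube `tubeN(o)` is the union of the NODE-77 tubes (own sites, C-beams to the feet, χ-beams into the transition
  bands; tree `tube`, radius `r`) of ALL heavy active octahedra whose first S-vertex lies within `R_N` of that of `o` (and of `o`'s own tube).  Beams
  still follow the gradient congruence (no poaching across medial sheets), but a crease octahedron now averages over the crease patch of radius
  `R_N` around it: in the starved dipole (`L = 118`) the apex sees the whole heavy disc (radius `≈ 39`, where the roof cost dies at depth `≈ 125`;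
  (Z_K) frees everything beyond depth `130`) and every heavy octahedron's coverage is the disc average `≈ 1.62` (area-averaged heavy cost
  `K̄ ≈ 21.7 c_T` per unit area against the apex `29.3`); over the starved dipole family `L ∈ [86, 122]` the worst heavy coverage is `1.23`
  (`L = 112`: a ring-shaped crease, at its outer edge), against `1.08` for `R_N = 60`; in laterally homogeneous geometries nothing changes (`1.165`).

## The cut

  (KX) ⟸ (Z_K) `SixFeetZeroConeQ (679/1000) (691/1000) 330 130 160` [tree leaf of NODE 77, unchanged · FINITE · cell-LP]
      ∧ (P_C) `CreasePoolQ cls₀ 80 3 20 130 106 …` [RESIDUAL-DECIDING · NEW · TRUE-leaning: starved slab `≥ 1/0.859 = 1.164` over the whole g76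
        grid (for a laterally homogeneous geometry `coverage ≥ (B − ℓ)/h ≥ B/(h + ℓ)` = the inverse g76 ratio), starved dipole family `≥ 1.23`
        (`num/RESULTS-g78.md` H3); T-junctions / cylinder axes not computed (census asks) · LOCAL (the fattened tube reaches `< R_N + ϱ + 2r₂ + r
        ≈ 246` from `o`, the loads on it are fixed within `≈ 490`) · INSTRUMENTABLE · ATTACKABLE-L]
      ∧ (P_D) `BandPoolQ cls₀ 80 3 20 130 106 …` [NEW · TRUE-leaning, margin `≈ 3` (bulk band edge, as (B_D)); light hoverers exempt; a heavy
        tame octahedron at height `h` inside a crease patch has footprint factor `((√(R_N² − h²) + r)/(R_N + r))²` (`0.92` at `h = 23`) · LOCAL]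
      ∧ (N_P) `PoolIncidenceQ cls₀ 80 3 20 130 106 …` [support · TRUE at the designate (`6κ ≤ c_T`; `36` ordered mid pairs per site; six
        vertices per framed pair) · ATTACKABLE-M: two periodic Fubini refoldings, no LP content].

Glue `creaseTransitionLedgerQ_of_pools`, designate `creaseTransitionLedgerQ_designate_of_pools` and the q-designate cone
`chargedEnergyGap_of_poolCells_numerics` are PROVED below (0 sorry).  Jointly the four leaves are STRONGER than (KX) (a specific transport).
Door beneath (P_C) [FOLD-TABLE, for g79]: (Φ) an any-feet cost table `frameVal ≤ Φ(pattern)` (upper bounds only; the dictionary `crease_frame`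
is in the tree) ∧ (Λ) a regional load bound `load ≤ Λ` from Φ and the CONVEXITY of `|x|² − dist(x, C)²` (second differences of a convex
function telescope along lattice lines: a line-density bound on crease cost, uniform in `C`) ∧ (M) `Σ_x pool(x)/Λ(x) ≥ 1` by profile arithmetic.

Imports ONLY the tree files `…ChargedEnergyGapBeamCells` (hence `…BeamCellsA`, `…RoofCover`) and `HarnessLib`; no `set_option`, no `sorry`,
no instance, no notation.  Same namespace as NODE 77; new declaration names `Light`, `HeavyActive`, `charges`, `pool`, `tubeN`, `load`,
`coverage`, `paid`, `CreasePoolQ`, `BandPoolQ`, `PoolIncidenceQ` (no clash in the tree namespace, checked).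
-/

noncomputable section

open scoped Classical
open Literature.MathematicalPhysics.StatisticalMechanics Literature.Geometry.DiscreteGeometry
open Summit.AtomisticToContinuum.Crystallization.Theses.PricedLinkCensus
open Summit.AtomisticToContinuum.Crystallization.Theorems.ChargedEnergyGapNegative

namespace Summit.AtomisticToContinuum.Crystallization.Theorems.ChargedEnergyGapChartDial

/-! ## §1 Light and heavy octahedra, the vertex charges, the pool, the fattened tubes, the load, the coverage and the payment -/

section Pools

variable (ϱχ : ℝ) {m : ℕ} (D : Fin m → Set E3) (σ : Fin m → Bool)

/-- ★ **LIGHT octahedron**: its cost `frameVal` is at most the budget atom of EACH of its sites (then its own six vertices pay it: the ordered pair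
charges `frameVal/36` to each of them, `charges`). -/
def Light (r_f dstar κ c_T cχ : ℝ) (P : PeriodicConfiguration 3) (C X : Set E3) (τ ϱ r₁ r₂ : ℝ) (y z : E3) : Prop :=
  ∀ v : E3, InOct P r₁ y z v →
    frameVal (roofVal T75) τ (siteW ϱχ D σ X ϱ C) P r₁ y z ≤ atom ϱχ D σ κ c_T cχ r_f dstar P C X ϱ r₁ r₂ v

/-- ★ **HEAVY ACTIVE octahedron**: active (tree `IsActive`: clean, non-plateau, in the residual class, positive cost) and not light. -/
def HeavyActive (r_f dK dstar κ c_T cχ : ℝ) (P : PeriodicConfiguration 3) (C X : Set E3) (τ ϱ r₁ r₂ : ℝ) (y z : E3) : Prop :=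
  IsActive ϱχ D σ r_f dK P C X τ ϱ r₁ r₂ y z ∧ ¬Light ϱχ D σ r_f dstar κ c_T cχ P C X τ ϱ r₁ r₂ y z

/-- The **VERTEX CHARGES** at `x`: every light active ordered mid pair having `x` as a site of its octahedron charges `frameVal/36` to it
(finsum over ordered pairs; `0` if the support were infinite). -/
def charges (r_f dK dstar κ c_T cχ : ℝ) (P : PeriodicConfiguration 3) (C X : Set E3) (τ ϱ r₁ r₂ : ℝ) (x : E3) : ℝ :=
  ∑ᶠ p : E3 × E3,
    if (IsActive ϱχ D σ r_f dK P C X τ ϱ r₁ r₂ p.1 p.2 ∧ Light ϱχ D σ r_f dstar κ c_T cχ P C X τ ϱ r₁ r₂ p.1 p.2) ∧ InOct P r₁ p.1 p.2 x then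
      (1 / 36) * frameVal (roofVal T75) τ (siteW ϱχ D σ X ϱ C) P r₁ p.1 p.2
    else 0

/-- The **POOL** at `x`: the budget atom minus the vertex charges, floored at `0` (non-negative by definition; at the designate the floor is
inactive: charges never exceed the atom). -/
def pool (r_f dK dstar κ c_T cχ : ℝ) (P : PeriodicConfiguration 3) (C X : Set E3) (τ ϱ r₁ r₂ : ℝ) (x : E3) : ℝ :=
  max 0 (atom ϱχ D σ κ c_T cχ r_f dstar P C X ϱ r₁ r₂ x - charges ϱχ D σ r_f dK dstar κ c_T cχ P C X τ ϱ r₁ r₂ x)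

/-- ★ The **N-FATTENED TUBE** of the octahedron of `(y, z)`: its own NODE-77 tube (own sites ∪ C-beam tube ∪ χ-beam tubes, radius `r`) together
with the tubes of all HEAVY ACTIVE octahedra `(y', z')` whose first S-vertex `y'` lies within `R_N` of `y`. -/
def tubeN (R_N r r_f dK dstar κ c_T cχ : ℝ) (P : PeriodicConfiguration 3) (C X : Set E3) (τ ϱ r₁ r₂ : ℝ) (y z : E3) : Set E3 :=
  {x | x ∈ tube ϱχ D r r_f ϱ C P r₁ y z ∨
    ∃ y' z' : E3, HeavyActive ϱχ D σ r_f dK dstar κ c_T cχ P C X τ ϱ r₁ r₂ y' z' ∧ dist y y' ≤ R_N ∧ x ∈ tube ϱχ D r r_f ϱ C P r₁ y' z'}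

/-- ★ The **LOAD** at `x`: the sum of `frameVal/6` over the heavy active ordered mid pairs whose fattened tube contains `x` (finsum; `0` if the
support were infinite — it is finite for a separated reference: fattened tubes have bounded reach). -/
def load (R_N r r_f dK dstar κ c_T cχ : ℝ) (P : PeriodicConfiguration 3) (C X : Set E3) (τ ϱ r₁ r₂ : ℝ) (x : E3) : ℝ :=
  ∑ᶠ p : E3 × E3,
    if HeavyActive ϱχ D σ r_f dK dstar κ c_T cχ P C X τ ϱ r₁ r₂ p.1 p.2 ∧
        x ∈ tubeN ϱχ D σ R_N r r_f dK dstar κ c_T cχ P C X τ ϱ r₁ r₂ p.1 p.2 then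
      (1 / 6) * frameVal (roofVal T75) τ (siteW ϱχ D σ X ϱ C) P r₁ p.1 p.2
    else 0

/-- ★ The **COVERAGE** of the octahedron of `(y, z)`: `Σ_x pool(x)/load(x)` over the reference sites `x` of its fattened tube — the income of a
heavy octahedron under COST-PROPORTIONAL sharing, divided by its sixth-cost. -/
def coverage (R_N r r_f dK dstar κ c_T cχ : ℝ) (P : PeriodicConfiguration 3) (C X : Set E3) (τ ϱ r₁ r₂ : ℝ) (y z : E3) : ℝ :=
  ∑ᶠ x : E3,
    if x ∈ P.points ∧ x ∈ tubeN ϱχ D σ R_N r r_f dK dstar κ c_T cχ P C X τ ϱ r₁ r₂ y z then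
      pool ϱχ D σ r_f dK dstar κ c_T cχ P C X τ ϱ r₁ r₂ x / load ϱχ D σ R_N r r_f dK dstar κ c_T cχ P C X τ ϱ r₁ r₂ x
    else 0

/-- ★ The **PAYMENT** to the ordered mid pair `(y, z)`: its sixth-cost if it is light (own vertices), else its sixth-cost times its coverage
(cost-proportional shares of the pool along its fattened tube). -/
def paid (R_N r r_f dK dstar κ c_T cχ : ℝ) (P : PeriodicConfiguration 3) (C X : Set E3) (τ ϱ r₁ r₂ : ℝ) (y z : E3) : ℝ :=
  if Light ϱχ D σ r_f dstar κ c_T cχ P C X τ ϱ r₁ r₂ y z then (1 / 6) * frameVal (roofVal T75) τ (siteW ϱχ D σ X ϱ C) P r₁ y z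
  else (1 / 6) * frameVal (roofVal T75) τ (siteW ϱχ D σ X ϱ C) P r₁ y z *
    coverage ϱχ D σ R_N r r_f dK dstar κ c_T cχ P C X τ ϱ r₁ r₂ y z

variable {ϱχ D σ}

/-- The pool is non-negative. [formal bookkeeping] -/
theorem pool_nonneg (r_f dK dstar κ c_T cχ : ℝ) (P : PeriodicConfiguration 3) (C X : Set E3) (τ ϱ r₁ r₂ : ℝ) (x : E3) :
    0 ≤ pool ϱχ D σ r_f dK dstar κ c_T cχ P C X τ ϱ r₁ r₂ x :=
  le_max_left _ _

/-- The load is non-negative (heavy active pairs have positive cost). [formal bookkeeping] -/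
theorem load_nonneg (R_N r r_f dK dstar κ c_T cχ : ℝ) (P : PeriodicConfiguration 3) (C X : Set E3) (τ ϱ r₁ r₂ : ℝ) (x : E3) :
    0 ≤ load ϱχ D σ R_N r r_f dK dstar κ c_T cχ P C X τ ϱ r₁ r₂ x := by
  unfold load
  refine finsum_nonneg fun p => ?_
  split_ifs with h
  · exact mul_nonneg (by norm_num) h.1.1.2.2.2.2.le
  · exact le_rfl

/-- The coverage is non-negative. [formal bookkeeping] -/
theorem coverage_nonneg (R_N r r_f dK dstar κ c_T cχ : ℝ) (P : PeriodicConfiguration 3) (C X : Set E3) (τ ϱ r₁ r₂ : ℝ) (y z : E3) :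
    0 ≤ coverage ϱχ D σ R_N r r_f dK dstar κ c_T cχ P C X τ ϱ r₁ r₂ y z := by
  unfold coverage
  refine finsum_nonneg fun x => ?_
  split_ifs
  · exact div_nonneg (pool_nonneg r_f dK dstar κ c_T cχ P C X τ ϱ r₁ r₂ x) (load_nonneg R_N r r_f dK dstar κ c_T cχ P C X τ ϱ r₁ r₂ x)
  · exact le_rfl

/-- The payment to an active pair is non-negative. [formal bookkeeping] -/
theorem paid_nonneg {R_N r r_f dK dstar κ c_T cχ : ℝ} {P : PeriodicConfiguration 3} {C X : Set E3} {τ ϱ r₁ r₂ : ℝ} {y z : E3}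
    (hA : IsActive ϱχ D σ r_f dK P C X τ ϱ r₁ r₂ y z) : 0 ≤ paid ϱχ D σ R_N r r_f dK dstar κ c_T cχ P C X τ ϱ r₁ r₂ y z := by
  unfold paid
  split_ifs
  · exact mul_nonneg (by norm_num) hA.2.2.2.2.le
  · exact mul_nonneg (mul_nonneg (by norm_num) hA.2.2.2.2.le) (coverage_nonneg R_N r r_f dK dstar κ c_T cχ P C X τ ϱ r₁ r₂ y z)

/-- ★ The sixth-cost of an active pair is at most its payment, provided its coverage is `≥ 1` in case it is heavy. [the pointwise step of the glue] -/
theorem frameVal_le_paid {R_N r r_f dK dstar κ c_T cχ : ℝ} {P : PeriodicConfiguration 3} {C X : Set E3} {τ ϱ r₁ r₂ : ℝ} {y z : E3}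
    (hA : IsActive ϱχ D σ r_f dK P C X τ ϱ r₁ r₂ y z)
    (hcov : ¬Light ϱχ D σ r_f dstar κ c_T cχ P C X τ ϱ r₁ r₂ y z → 1 ≤ coverage ϱχ D σ R_N r r_f dK dstar κ c_T cχ P C X τ ϱ r₁ r₂ y z) :
    (1 / 6) * frameVal (roofVal T75) τ (siteW ϱχ D σ X ϱ C) P r₁ y z ≤ paid ϱχ D σ R_N r r_f dK dstar κ c_T cχ P C X τ ϱ r₁ r₂ y z := by
  unfold paid
  split_ifs with hL
  · exact le_rfl
  · exact le_mul_of_one_le_right (mul_nonneg (by norm_num) hA.2.2.2.2.le) (hcov hL)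

end Pools

/-! ## §2 The leaves -/

section Leaves

/-- ★★★ **(P_C) THE CREASE POOL INEQUALITY** — per octahedron, LOCAL (radius `< R_N + ϱ + 2r₂ + r`): a HEAVY ACTIVE CREASED octahedron (feet of
its sites more than `r_f` apart — folds, ridges, junctions of `dist(·, C)` at crease depth `< d_K`, whatever its χ-status; cost above the atom of
one of its sites) has COVERAGE at least `1`: the pool of the reference sites of its N-fattened tube, each divided by its load, adds up to `≥ 1` —
equivalently its cost-proportional income `(1/6)·frameVal·coverage` pays its sixth-cost.
[RESIDUAL-DECIDING · NEW as typed · TRUE-leaning: starved slab `≥ 1.164` on the whole g76 grid (hoverers are light and only subtract their own cost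
`0.47` of `34.15 c_T` per unit area from the pool), starved dipole apex `≈ 1.7`, V-folds `≥ 2.6`, junction cores `≥ 7` · LOCAL · INSTRUMENTABLE
(one octahedron + radius `≈ 246`) · ATTACKABLE-L; door [FOLD-TABLE]: (Φ) any-feet cost table `frameVal ≤ Φ` ∧ (Λ) regional load bound from Φ
and the convexity of `|x|² − dist(x,C)²` ∧ (M) `Σ pool/Λ ≥ 1` by profile arithmetic] -/
def CreasePoolQ (cls : Set E3 → Prop) (R_N r r_f dK dstar κ c_T cχ : ℝ) (s lam ℓ τ ϱ ϱχ r₁ r₂ ρlo ρhi : ℝ) : Prop :=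
  ∀ (P : PeriodicConfiguration 3) (C X : Set E3) (m : ℕ) (D : Fin m → Set E3) (σ : Fin m → Bool),
    IsSeparatedRef s P → IsLabelledRef lam ℓ P → cls P.points → IsForceFree P → IsSiteStressFree P →
    IsInvariantSet P C → IsInvariantSet P X → (∀ i, IsInvariantSet P (D i)) → IsFramedOct P r₁ r₂ ρlo ρhi →
    ∀ y z : E3, HeavyActive ϱχ D σ r_f dK dstar κ c_T cχ P C X τ ϱ r₁ r₂ y z → ¬OctTame r_f C P r₁ y z →
      1 ≤ coverage ϱχ D σ R_N r r_f dK dstar κ c_T cχ P C X τ ϱ r₁ r₂ y z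

/-- ★★★ **(P_D) THE BAND POOL INEQUALITY** — per octahedron, LOCAL: a HEAVY ACTIVE TAME octahedron (one foot cluster on `C`; being active and tame
it TOUCHES A χ-TRANSITION — its cost is the roughness of a localisation factor across it, worst at the far edge `dist(·, Dᵢ) → ϱχ⁻` of a «near Dᵢ»
factor) has coverage `≥ 1` (pool of its own sites and of the χ-beam tubes INTO the transition bands of all heavy active octahedra within `R_N`).
[NEW as typed · TRUE-leaning with margin: bulk band «near» factor edge `(74, 79.5)`: cost `21–62 c_T` per octahedron vs band column of `cχ`-atoms
`≈ 200 c_T` per costly octahedron — margin `≈ 3` (the fattening is neutral in a homogeneous band); cheap χ-touching octahedra inside crease columns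
(«hoverers») are LIGHT by a factor `≥ 9` and not concerned; a hypothetical heavy one at height `h` in a crease patch keeps the crease's coverage up
to the footprint factor `((√(R_N² − h²) + r)/(R_N + r))²` (`≥ 0.92` for `h ≤ 23`, `R_N = 80`) · LOCAL · INSTRUMENTABLE · ATTACKABLE-L; door
[EDGE-TABLE] as for NODE 77's (B_D)] -/
def BandPoolQ (cls : Set E3 → Prop) (R_N r r_f dK dstar κ c_T cχ : ℝ) (s lam ℓ τ ϱ ϱχ r₁ r₂ ρlo ρhi : ℝ) : Prop :=
  ∀ (P : PeriodicConfiguration 3) (C X : Set E3) (m : ℕ) (D : Fin m → Set E3) (σ : Fin m → Bool),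
    IsSeparatedRef s P → IsLabelledRef lam ℓ P → cls P.points → IsForceFree P → IsSiteStressFree P →
    IsInvariantSet P C → IsInvariantSet P X → (∀ i, IsInvariantSet P (D i)) → IsFramedOct P r₁ r₂ ρlo ρhi →
    ∀ y z : E3, HeavyActive ϱχ D σ r_f dK dstar κ c_T cχ P C X τ ϱ r₁ r₂ y z → OctTame r_f C P r₁ y z →
      1 ≤ coverage ϱχ D σ R_N r r_f dK dstar κ c_T cχ P C X τ ϱ r₁ r₂ y z

/-- ★★ **(N_P) POOL INCIDENCE** (periodic double counting, twice): summed over the active mid pairs of one period, the payments amount to at most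
the budget of (KX) without the near-priced term.  Light pairs: `(1/6)·frameVal = Σ over the six sites of frameVal/36` (framed octahedra), refolded
over the period = `Σ_x charges(x)`; heavy pairs: `Σ (1/6)·frameVal·coverage = Σ_x pool(x)·[load(x) > 0] ≤ Σ_x pool(x)`; and `charges + pool =
max(atom, charges) = atom` because a site of the cubic fcc reference is a site of `36` ordered mid pairs, each light one charging at most `atom/36`;
finally `Σ_{x ∈ motif} atom(x)` is the right-hand side termwise.
[support · TRUE at the designate (`6κ ≤ c_T`) · ATTACKABLE-M (periodic Fubini as (I₃₆)/(N_B); lattice invariance of `atom`, `charges`, `tubeN`,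
`load`, `Light`, `IsActive`; local finiteness of the finsum supports) · no LP content] -/
def PoolIncidenceQ (cls : Set E3 → Prop) (R_N r r_f dK dstar κ c_T cχ : ℝ) (s lam ℓ τ ϱ ϱχ r₁ r₂ ρlo ρhi : ℝ) : Prop :=
  ∀ (P : PeriodicConfiguration 3) (C X : Set E3) (m : ℕ) (D : Fin m → Set E3) (σ : Fin m → Bool),
    IsSeparatedRef s P → IsLabelledRef lam ℓ P → cls P.points → IsInvariantSet P C → IsInvariantSet P X → (∀ i, IsInvariantSet P (D i)) →
    IsFramedOct P r₁ r₂ ρlo ρhi →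
      ∑ y ∈ P.motif, ∑ᶠ z : E3, (if (z ∈ P.points ∧ r₁ < dist y z ∧ dist y z ≤ r₂) ∧ IsActive ϱχ D σ r_f dK P C X τ ϱ r₁ r₂ y z then
          paid ϱχ D σ R_N r r_f dK dstar κ c_T cχ P C X τ ϱ r₁ r₂ y z else 0) ≤
        c_T * shellMassL ϱχ D σ P X ϱ C - 6 * κ * sVertMassL ϱχ D σ r_f dstar P C X ϱ r₁ r₂ + cχ * transMassL ϱχ D σ P X ϱ C

end Leaves

/-! ## §3 The glue: (Z_K) ∧ (P_C) ∧ (P_D) ∧ (N_P) ⟹ (KX) -/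

section Glue

variable {ϱχ : ℝ}

/-- ★★★ **GLUE OF NODE 78 (PROVED)**: (Z_K) ∧ (P_C) ∧ (P_D) ∧ (N_P) ⟹ (KX) `CreaseTransitionLedgerQ` (same constants, `c_H := 0`), for any class,
whenever `0 < ϱ`, `0 < ϱχ`, `0 ≤ r₁`, octahedra small against the χ-scale, positive half-diagonal window and `R_Z ≥ 2ϱ + 6ρhi`.  The residual class
`¬(χ-free ∧ tame)` is PARTITIONED into the χ-free deep creases (free by (Z_K)), the inactive rest (frame-infimum `≤ 0`, free by definition) and the
ACTIVE octahedra, each paid at least its sixth-cost (`frameVal_le_paid`: light ones by definition, heavy creased ones by (P_C), heavy tame ones by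
(P_D)); the payments of one period add up to at most the budget by (N_P). -/
theorem creaseTransitionLedgerQ_of_pools {cls : Set E3 → Prop} {R_N r r_f dK R_Z dstar κ c_T cχ s lam ℓ τ ϱ ϱχ r₁ r₂ ρlo ρhi : ℝ}
    (hs : 0 < s) (hϱ : 0 < ϱ) (hϱχ : 0 < ϱχ) (hr₁ : 0 ≤ r₁) (hsmall : 2 * (r₁ + r₂) < ϱχ / 2) (hlo : 0 < ρlo) (hR : 2 * ϱ + 6 * ρhi ≤ R_Z)
    (hZ : SixFeetZeroConeQ ρlo ρhi R_Z dK ϱ)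
    (hPC : CreasePoolQ cls R_N r r_f dK dstar κ c_T cχ s lam ℓ τ ϱ ϱχ r₁ r₂ ρlo ρhi)
    (hPD : BandPoolQ cls R_N r r_f dK dstar κ c_T cχ s lam ℓ τ ϱ ϱχ r₁ r₂ ρlo ρhi)
    (hN : PoolIncidenceQ cls R_N r r_f dK dstar κ c_T cχ s lam ℓ τ ϱ ϱχ r₁ r₂ ρlo ρhi) :
    CreaseTransitionLedgerQ cls r_f dstar κ s lam ℓ τ ϱ ϱχ r₁ r₂ ρlo ρhi c_T cχ := by
  refine ⟨0, le_rfl, fun P C X m D σ h1 h2 hcl h3 h4 h6' h7 h11 hFr => ?_⟩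
  -- abbreviations of the octahedron predicates
  set cf : E3 → E3 → Prop := fun y z => OctChiFree ϱχ D P r₁ y z with hcf
  set tm : E3 → E3 → Prop := fun y z => OctTame r_f C P r₁ y z with htm
  set dp : E3 → E3 → Prop := fun y z => OctDeep dK C P r₁ y z with hdp
  set fv : E3 → E3 → ℝ := fun y z => frameVal (roofVal T75) τ (siteW ϱχ D σ X ϱ C) P r₁ y z with hfv
  -- the partition  KX = Z ⊔ R,  R = N ⊔ A
  have s1 := fShellSel_split (ϱχ := ϱχ) (D := D) (σ := σ) (π := fun y z => ¬(cf y z ∧ tm y z))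
    (π₁ := fun y z => cf y z ∧ ¬tm y z ∧ dp y z)
    (π₂ := fun y z => ¬(cf y z ∧ tm y z) ∧ ¬(cf y z ∧ ¬tm y z ∧ dp y z)) h1 hs
    (fun y z => by
      constructor
      · intro h
        by_cases hZ' : cf y z ∧ ¬tm y z ∧ dp y z
        · exact Or.inl hZ'
        · exact Or.inr ⟨h, hZ'⟩
      · rintro (h | h)
        · exact fun h' => h.2.1 h'.2
        · exact h.1)
    (fun y z h => h.2.2 h.1) (roofVal T75) r₁ r₂ τ X ϱ C
  have s2 := fShellSel_split (ϱχ := ϱχ) (D := D) (σ := σ)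
    (π := fun y z => ¬(cf y z ∧ tm y z) ∧ ¬(cf y z ∧ ¬tm y z ∧ dp y z))
    (π₁ := fun y z => (¬(cf y z ∧ tm y z) ∧ ¬(cf y z ∧ ¬tm y z ∧ dp y z)) ∧ ¬(0 < fv y z))
    (π₂ := fun y z => (¬(cf y z ∧ tm y z) ∧ ¬(cf y z ∧ ¬tm y z ∧ dp y z)) ∧ 0 < fv y z) h1 hs
    (fun y z => by
      constructor
      · intro h
        by_cases hp : 0 < fv y z
        · exact Or.inr ⟨h, hp⟩
        · exact Or.inl ⟨h, hp⟩
      · rintro (h | h) <;> exact h.1)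
    (fun y z h => h.1.2 h.2.2) (roofVal T75) r₁ r₂ τ X ϱ C
  -- (Z_K): the χ-free deep creases are free
  have eZ : fShellSel ϱχ D σ (fun y z => cf y z ∧ ¬tm y z ∧ dp y z) (roofVal T75) r₁ r₂ τ P X ϱ C ≤ 0 :=
    fShellSel_nonpos h1 hs fun y hy z hz hd1 hd2 hc hp hπ =>
      frameVal_nonpos_of_anyFeetZeroCone hϱ hϱχ hr₁ hsmall hlo hR hZ hFr (P.mem_points_of_mem_motif hy) hz hd1 hd2 hc hp hπ.1 hπ.2.2
  -- the inactive rest is free by definition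
  have eN : fShellSel ϱχ D σ (fun y z => (¬(cf y z ∧ tm y z) ∧ ¬(cf y z ∧ ¬tm y z ∧ dp y z)) ∧ ¬(0 < fv y z))
      (roofVal T75) r₁ r₂ τ P X ϱ C ≤ 0 :=
    fShellSel_nonpos h1 hs fun y _ z _ _ _ _ _ hπ => not_lt.1 hπ.2
  -- the active octahedra are paid at least their sixth-costs
  set R : E3 → E3 → ℝ := fun y z =>
    if IsActive ϱχ D σ r_f dK P C X τ ϱ r₁ r₂ y z then paid ϱχ D σ R_N r r_f dK dstar κ c_T cχ P C X τ ϱ r₁ r₂ y z else 0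
    with hRdef
  have hR0 : ∀ y z, 0 ≤ R y z := fun y z => by
    simp only [hRdef]
    split_ifs with hA
    · exact paid_nonneg hA
    · exact le_rfl
  have eA : fShellSel ϱχ D σ (fun y z => (¬(cf y z ∧ tm y z) ∧ ¬(cf y z ∧ ¬tm y z ∧ dp y z)) ∧ 0 < fv y z)
      (roofVal T75) r₁ r₂ τ P X ϱ C ≤
      ∑ y ∈ P.motif, ∑ᶠ z : E3, (if z ∈ P.points ∧ r₁ < dist y z ∧ dist y z ≤ r₂ then R y z else 0) := by
    refine fShellSel_le_of_termwise h1 hs R hR0 fun y hy z hz hd1 hd2 hc hp hπ => ?_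
    have hact : IsActive ϱχ D σ r_f dK P C X τ ϱ r₁ r₂ y z := by
      refine ⟨⟨P.mem_points_of_mem_motif hy, hz, hd1, hd2⟩, hc, hp, ?_, hπ.2⟩
      rintro ⟨hc', ht' | hd'⟩
      · exact hπ.1.1 ⟨hc', ht'⟩
      · by_cases ht : tm y z
        · exact hπ.1.1 ⟨hc', ht⟩
        · exact hπ.1.2 ⟨hc', ht, hd'⟩
    have hRe : R y z = paid ϱχ D σ R_N r r_f dK dstar κ c_T cχ P C X τ ϱ r₁ r₂ y z := by simp only [hRdef, if_pos hact]
    rw [hRe]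
    refine frameVal_le_paid hact fun hH => ?_
    by_cases ht : OctTame r_f C P r₁ y z
    · exact hPD P C X m D σ h1 h2 hcl h3 h4 h6' h7 h11 hFr y z ⟨hact, hH⟩ ht
    · exact hPC P C X m D σ h1 h2 hcl h3 h4 h6' h7 h11 hFr y z ⟨hact, hH⟩ ht
  -- (N_P): the payments add up to the budget
  have eI := hN P C X m D σ h1 h2 hcl h6' h7 h11 hFr
  have hsum : ∑ y ∈ P.motif, ∑ᶠ z : E3, (if z ∈ P.points ∧ r₁ < dist y z ∧ dist y z ≤ r₂ then R y z else 0) =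
      ∑ y ∈ P.motif, ∑ᶠ z : E3, (if (z ∈ P.points ∧ r₁ < dist y z ∧ dist y z ≤ r₂) ∧ IsActive ϱχ D σ r_f dK P C X τ ϱ r₁ r₂ y z then
          paid ϱχ D σ R_N r r_f dK dstar κ c_T cχ P C X τ ϱ r₁ r₂ y z else 0) := by
    refine Finset.sum_congr rfl fun y _ => finsum_congr fun z => ?_
    by_cases hA : z ∈ P.points ∧ r₁ < dist y z ∧ dist y z ≤ r₂
    · by_cases hB : IsActive ϱχ D σ r_f dK P C X τ ϱ r₁ r₂ y z
      · rw [if_pos hA, if_pos ⟨hA, hB⟩]; simp only [hRdef, if_pos hB]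
      · rw [if_pos hA, if_neg fun h => hB h.2]; simp only [hRdef, if_neg hB]
    · rw [if_neg hA, if_neg fun h => hA h.1]
  rw [s1, s2, zero_mul, add_zero]
  rw [hsum] at eA
  linarith

end Glue

/-! ## §4 The designate: NODE 78 beneath NODE 76R, and the q-designate cone through the pool cells -/

section Designate

/-- ★★★ **NODE 78 AT THE DESIGNATE (PROVED)**: with fattening radius `R_N = 80`, beam radius `r = 3`, `r_f = 20`, crease depth `d_K = 130`, feet
diameter `R_Z = 330`, `d⋆ = 106`, `κ = c_T/60`: (Z_K) ∧ (P_C) ∧ (P_D) ∧ (N_P) ⟹ (KX) `CreaseTransitionLedgerQ cls₀ 20 106 (1/3600000000) (3/5)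
(1/3) 3 (3/100) 160 80 (6/5) (3/2) (679/1000) (691/1000) (1/60000000) (1/2000000)`. -/
theorem creaseTransitionLedgerQ_designate_of_pools
    (hZK : SixFeetZeroConeQ (679 / 1000) (691 / 1000) 330 130 160)
    (hPC : CreasePoolQ cls₀ 80 3 20 130 106 (1 / 3600000000) (1 / 60000000) (1 / 2000000) (3 / 5) (1 / 3) 3 (3 / 100) 160 80 (6 / 5)
      (3 / 2) (679 / 1000) (691 / 1000))
    (hPD : BandPoolQ cls₀ 80 3 20 130 106 (1 / 3600000000) (1 / 60000000) (1 / 2000000) (3 / 5) (1 / 3) 3 (3 / 100) 160 80 (6 / 5)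
      (3 / 2) (679 / 1000) (691 / 1000))
    (hN : PoolIncidenceQ cls₀ 80 3 20 130 106 (1 / 3600000000) (1 / 60000000) (1 / 2000000) (3 / 5) (1 / 3) 3 (3 / 100) 160 80 (6 / 5)
      (3 / 2) (679 / 1000) (691 / 1000)) :
    CreaseTransitionLedgerQ cls₀ 20 106 (1 / 3600000000) (3 / 5) (1 / 3) 3 (3 / 100) 160 80 (6 / 5) (3 / 2) (679 / 1000) (691 / 1000)
      (1 / 60000000) (1 / 2000000) :=
  creaseTransitionLedgerQ_of_pools (by norm_num) (by norm_num) (by norm_num) (by norm_num) (by norm_num) (by norm_num) (by norm_num)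
    hZK hPC hPD hN

/-- ★★★ **THE q-DESIGNATE THROUGH THE POOL CELLS**: the tree cone `chargedEnergyGap_of_roofCover_numerics` with (KX) replaced by the four leaves of
NODE 78 — (Z_K) `SixFeetZeroConeQ … 330 130 160`, (P_C) `CreasePoolQ`, (P_D) `BandPoolQ`, (N_P) `PoolIncidenceQ` — everything else verbatim. -/
theorem chargedEnergyGap_of_poolCells_numerics {b₁ : ℝ} (hb : 1 / 8 ≤ b₁) (hU : Fcc.FccScaleNumerics) (hF : ChargeRecount)
    (hIP : ImprovablePricingG (3 / 20) (1 / 10) (6 / 5) 10 (1 / 100) (3 / 5))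
    (hFCP : FrustratedCorePricingG (3 / 20) (1 / 10) (6 / 5) 10 (1 / 100) 40 (3 / 5))
    (hCCP : CoherentCorePricingG (3 / 20) (1 / 10) (6 / 5) 10 (1 / 100) 40 (1 / 10) 40 (3 / 5))
    (hB : CoreBallRegularPricingW (maxCoverWeights (3 / 20) (1 / 10) (6 / 5) 10 (1 / 100) 40 (1 / 10) 40 160) (1 / 20) (3 / 5) 10
      fun _ _ => True)
    (hLab : CleanLabellingW (maxCoverWeights (3 / 20) (1 / 10) (6 / 5) 10 (1 / 100) 40 (1 / 10) 40 160) (3 / 5) 10 (1 / 3) 3)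
    (hSB : ShellBudgetW (maxCoverWeights (3 / 20) (1 / 10) (6 / 5) 10 (1 / 100) 40 (1 / 10) 40 160) (3 / 5) 100000)
    (hLf : LoadBoundQ IsFccImage (3 / 5) (1 / 3) 3 (1 / 100) (3 / 100) 160 (2 / 5) 3 b₁ 80 (6 / 5) (3 / 4) (3 / 10000000) (9 / 1000000))
    (hNf : NnStiffCls IsFccImage (27 / 10) (6 / 5))
    (hOL : OctLedgerQ (IsCubicFccImage (1921 / 2000) (977 / 1000)) (3 / 5) (1 / 3) 3 (1 / 100) (3 / 100) 160 (2 / 5) 3 b₁ 80 (6 / 5) (3 / 2)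
      (1 / 2) (679 / 1000) (691 / 1000))
    (hA : A0Plus) (hSh : ShellIsSecond (IsCubicFccImage (Fcc.a0 * Real.sqrt 2) (Fcc.a0 * Real.sqrt 2)))
    (hT : RoofTableQ (471 / 1000) T75)
    (hZ : SixFeetZeroConeQ (679 / 1000) (691 / 1000) 20 106 160)
    (hCap : SixFeetShallowCapQ (679 / 1000) (691 / 1000) 20 106 160 (3 / 100) (1 / 3600000000))
    (hI : SVertexIncidenceQ cls₀ 20 106 36 (3 / 5) (1 / 3) 3 160 80 (6 / 5) (3 / 2))
    (hZK : SixFeetZeroConeQ (679 / 1000) (691 / 1000) 330 130 160)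
    (hPC : CreasePoolQ cls₀ 80 3 20 130 106 (1 / 3600000000) (1 / 60000000) (1 / 2000000) (3 / 5) (1 / 3) 3 (3 / 100) 160 80 (6 / 5)
      (3 / 2) (679 / 1000) (691 / 1000))
    (hPD : BandPoolQ cls₀ 80 3 20 130 106 (1 / 3600000000) (1 / 60000000) (1 / 2000000) (3 / 5) (1 / 3) 3 (3 / 100) 160 80 (6 / 5)
      (3 / 2) (679 / 1000) (691 / 1000))
    (hNP : PoolIncidenceQ cls₀ 80 3 20 130 106 (1 / 3600000000) (1 / 60000000) (1 / 2000000) (3 / 5) (1 / 3) 3 (3 / 100) 160 80 (6 / 5)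
      (3 / 2) (679 / 1000) (691 / 1000))
    (hFf : FarTrussQ IsFccImage (3 / 5) (1 / 3) 3 (1 / 100) (3 / 100) 160 (2 / 5) 3 b₁ 80 (6 / 5) (3 / 2) (11 / 20) (1 / 25) (1 / 60000000)
      (1 / 2000000))
    (hGf : GeoExchQ IsFccImage (3 / 5) (1 / 3) 3 (1 / 100) (3 / 100) 160 (2 / 5) 3 b₁ 80 (6 / 5) (3 / 20) (1 / 25) (1 / 30000000) (1 / 1000000))
    (hLh : LoadBoundQ IsHcpImage (3 / 5) (1 / 3) 3 (1 / 100) (3 / 100) 160 (2 / 5) 3 b₁ 80 (6 / 5) (3 / 4) (3 / 10000000) (9 / 1000000))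
    (hNh : NnStiffCls IsHcpImage (27 / 10) (6 / 5))
    (hMh : MidTrussQ IsHcpImage (3 / 5) (1 / 3) 3 (1 / 100) (3 / 100) 160 (2 / 5) 3 b₁ 80 (6 / 5) (3 / 2) (1 / 2) 0 (1 / 60000000) (1 / 2000000))
    (hFh : FarTrussQ IsHcpImage (3 / 5) (1 / 3) 3 (1 / 100) (3 / 100) 160 (2 / 5) 3 b₁ 80 (6 / 5) (3 / 2) (1 / 2) (1 / 40) (1 / 60000000)
      (1 / 2000000))
    (hGh : GeoExchQ IsHcpImage (3 / 5) (1 / 3) 3 (1 / 100) (3 / 100) 160 (2 / 5) 3 b₁ 80 (6 / 5) (1 / 5) (1 / 40) (1 / 30000000) (1 / 1000000))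
    (hN : LocalSeamReductionQ (3 / 5) (1 / 3) 3 (1 / 100) (3 / 100) (1 / 2) 160 (2 / 5) 3 b₁ 80 (1 / 3000000) (1 / 100000)
      (maxCoverWeights (3 / 20) (1 / 10) (6 / 5) 10 (1 / 100) 40 (1 / 10) 40 160) (1 / 20) 10 100000)
    (hP : ChartedChargePricingG (3 / 20) (1 / 10) (3 / 5)) : ChargedEnergyGap :=
  chargedEnergyGap_of_roofCover_numerics hb hU hF hIP hFCP hCCP hB hLab hSB hLf hNf hOL hA hSh hT hZ hCap hI
    (creaseTransitionLedgerQ_designate_of_pools hZK hPC hPD hNP) hFf hGf hLh hNh hMh hFh hGh hN hP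

end Designate

end Summit.AtomisticToContinuum.Crystallization.Theorems.ChargedEnergyGapChartDial
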